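import Summits.QuantumFields.YangMills.Theorems.UnitScaleTiltCurvGradAxialFlat
import Literature.MathematicalPhysics.QuantumFieldTheory.Balaban1983to89.B10Eq68TorusRegularity
import Literature.MathematicalPhysics.QuantumFieldTheory.Balaban1983to89.T3ContinuumYM3Torus
import HarnessLib

/-!
# Route `UnitScaleTilt`, crux K1 child «MinimiserStabilityRegPr» (stmt-QuantumFields-19200), registered stub `stub_prop7From14` (V3, skeleton v7
# cc37a1787726) — lane B «regularity of the constrained minimiser from the Euler–Lagrange system»: **THE FLAT LINEARISATION OF THE CURRENT** —
# the covariant divergence `(D^{1*}_U ∂U)_μ(x)` of the plaquette field of a near-identity configuration `U = 1 + Y` ([Balaban1985RegularSpaces] (1.2):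
# the quantity of the divergence clause of [Balaban1985Variational] (2) and the flat-background Euler–Lagrange current `J` of (26)–(28)) IS the flat
# second-order operator `div₂(curl Y)` up to a remainder of THIRD ORDER: `‖div₂(curl Y)(x; μ) − (D^{1*}_U ∂U)_μ(x)‖ ≤ d·(2·a·f + 2·f² + 16·a·g)`,
# `a = sup‖Y‖`, `f = sup‖U(∂p) − 1‖`, `g = sup‖Y(· − e_ν) − Y(·)‖`

Cell `ym3-torus` ∕ fleet seat `ym-ust-19200-p3` (WIDTH-LEVER lane B of V3; HUMAN RULING D-0037, YM ladder rung R3).  `--supports stmt-QuantumFields-19200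
--as helper`.  WHAT THIS IS NOT: no gauge is constructed, no Euler–Lagrange equation is derived, nothing of Bałaban's analysis is asserted.  NOT a claim
about the mass gap.

WHY.  The lane-B regularity lemma (`Prop7FlatSliceRegularity(T3)`, p528434/p529165/p529864: on print's flat Landau slice `sup|A| ≤ C_G·sup|∂*∂A − Q*ω| +
C_H·(…)`) consumes the LINEARISED current `∂*∂A`; the Euler–Lagrange system and the divergence clause of (2) speak of the TRUE current `D^{1*}_U ∂U`.  For the
bootstrap ([Balaban1985Variational] (133)–(136), (165); [Balaban1985RegularSpaces] Prop. 6 (1.136)) the difference must be of THIRD order in the scaled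
quantities (`a ~ εL^{−k}`, `f ~ εL^{−2k}`, `g ~ εL^{−2k}`; a crude `a²` would not do): the quadratic part `F − 1 − curl Y` of the plaquette field is NOT small
enough pointwise, but its flat DIFFERENCES are, because every term of the telescoped difference of two neighbouring plaquette products carries one bond
gradient AND one bond deviation (§1).  The covariant-versus-flat divergence of `F − 1` is p1 g13's `CurvGradAxial.norm_div2_sub_covDiv_le` (`d(2af + 2f²)`,
reversed orientations included); this file adds the second-order telescoping and assembles.

WHAT IS PROVED (sorry-free, no definition, standard axioms).
* §1 (any normed ring): `norm_mul_sub_one_le` & co. (`‖xy − 1‖ ≤ ‖x − 1‖ + ‖y − 1‖` for `‖y‖ ≤ 1`), `inv_sub_inv_eq` (`u⁻¹ − v⁻¹ = −u⁻¹(u − v)v⁻¹`),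
  **`norm_plaq_second_order_diff_le`**: for `U1`-units within `a` of `1` with `‖uᵢ − vᵢ‖ ≤ g`,
  `‖E(u) − E(v)‖ ≤ 16·a·g`, `E(u) = u₁u₂u₃⁻¹u₄⁻¹ − 1 − [(u₁−1) + (u₂−1) − (u₃−1) − (u₄−1)]` (explicit four-term telescoping).
* §2 (`ℤ^d`, the `B7Prop1Explicit`/`B8Ineq132` letters `hol`, `plaqF`, `covDiv`, `U1`; `LatticeChain.div₂`): `plaqF_eq_units_prod`, `div₂_apply`,
  **`norm_plaqF_second_order_diff_le`** (`‖E(y − e_ν) − E(y)‖ ≤ 16ag` for the plaquette field), **`norm_div2_curl_sub_covDiv_le`**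
  (`‖div₂(curl Y)(y;μ) − (D^{1*}_W∂W)_μ(y)‖ ≤ d(2af + 2f² + 16ag)`, `curl Y(z;κ,μ) = Y(z,κ) + Y(z+e_κ,μ) − Y(z+e_μ,κ) − Y(z,μ)` over ALL ordered pairs).
* §3 (the Setup torus, `B10Eq68TorusRegularity.covDivT/plaqFT`, through the periodic pullback `B10Eq27TorusAxialLog.pull`):
  **`norm_div2_curl_sub_covDivT_le`** — the same for every `U1`-valued `V : GaugeField P s 𝔸ˣ`, with torus shifts.
* §4 the d = 3 carrier (`M₂(ℂ)`, operator norm, unitary-valued units, e.g. `unitsField (toUField U)`): `norm_div2_curl_sub_covDivT_le_T3` (constant `3(…)`),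
  `unitsField_toUField_mem_unitaryUnits`.
HONEST SCOPE.  (i) Flat background only (`U₀ = 1`); at a background the same telescoping works with `Y = UU₀⁻¹ − 1` and covariant flat operators (not written).
(ii) `Y = U − 1`, not `log U`: the difference is of second order with third-order flat differences as well (consumer's one-liner with `exp`).  (iii) The
identification of `div₂(curl Y)` (componentwise, real components) with the V1 letter `dcsE (dcE ·)` of `B6SectAOperatorsV1` — an adjoint computation — is
NOT done here.  (iv) Constants crude.

References: T. Bałaban, CMP **99** (1985) 75–102 [Balaban1985RegularSpaces] ((1.1)–(1.2) p.76, Prop. 6 (1.136) p.99); CMP **102** (1985) 277–309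
[Balaban1985Variational] ((2) p.278, (22)–(28) pp.281–282, (133)–(136) p.298, (165) p.303); CMP **98** (1985) 17–51 [Balaban1985Averaging] ((9), (19) pp.18–21).
-/

set_option autoImplicit false

noncomputable section

open scoped BigOperators

namespace Summit.QuantumFields.YangMills.Theorems.Prop7FlatCurrentLinearisation

open Finset
open Literature.MathematicalPhysics.QuantumFieldTheory.Balaban1983to89
open B7Prop1Explicit (e hol plaqWord U1 mem_U1 hol_mem norm_inv_sub_one_le)
open B8Ineq132 (plaqF covDeriv covDiv)
open Literature.MathematicalPhysics.QuantumFieldTheory.LatticeChain (div₂)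
open Summit.QuantumFields.YangMills.Theorems.CurvGradAxial (norm_div2_sub_covDiv_le hol_plaqWord_eq)

/-! ## §1 Normed-ring algebra: the second-order part of a plaquette product has differences of third order -/

section Ring

variable {𝔸 : Type*} [NormedRing 𝔸]

/-- `‖xy − 1‖ ≤ ‖x − 1‖ + ‖y − 1‖` for `‖y‖ ≤ 1` (`xy − 1 = (x − 1)y + (y − 1)`). [folklore] -/
theorem norm_mul_sub_one_le {x y : 𝔸} (hy : ‖y‖ ≤ 1) : ‖x * y - 1‖ ≤ ‖x - 1‖ + ‖y - 1‖ := by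
  have h : x * y - 1 = (x - 1) * y + (y - 1) := by noncomm_ring
  rw [h]
  refine (norm_add_le _ _).trans (add_le_add ?_ le_rfl)
  exact (norm_mul_le _ _).trans (mul_le_of_le_one_right (norm_nonneg _) hy)

/-- three factors. [folklore] -/
theorem norm_mul_mul_sub_one_le {x y z : 𝔸} (hy : ‖y‖ ≤ 1) (hz : ‖z‖ ≤ 1) :
    ‖x * y * z - 1‖ ≤ ‖x - 1‖ + ‖y - 1‖ + ‖z - 1‖ := by
  have h1 := norm_mul_sub_one_le (x := x * y) hz
  have h2 := norm_mul_sub_one_le (x := x) hy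
  linarith

/-- four factors. [folklore] -/
theorem norm_mul_mul_mul_sub_one_le {x y z t : 𝔸} (hy : ‖y‖ ≤ 1) (hz : ‖z‖ ≤ 1) (ht : ‖t‖ ≤ 1) :
    ‖x * y * z * t - 1‖ ≤ ‖x - 1‖ + ‖y - 1‖ + ‖z - 1‖ + ‖t - 1‖ := by
  have h1 := norm_mul_sub_one_le (x := x * y * z) ht
  have h2 := norm_mul_mul_sub_one_le (x := x) hy hz
  linarith

/-- `u⁻¹ − v⁻¹ = −u⁻¹(u − v)v⁻¹` for units. [folklore] -/
theorem inv_sub_inv_eq (u v : 𝔸ˣ) :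
    ((u⁻¹ : 𝔸ˣ) : 𝔸) - ((v⁻¹ : 𝔸ˣ) : 𝔸) = -(((u⁻¹ : 𝔸ˣ) : 𝔸) * ((u : 𝔸) - (v : 𝔸)) * ((v⁻¹ : 𝔸ˣ) : 𝔸)) := by
  rw [mul_sub, sub_mul, Units.inv_mul, one_mul, mul_assoc, Units.mul_inv, mul_one]
  abel

variable [NormOneClass 𝔸]

/-- **THE SECOND-ORDER PART OF A PLAQUETTE PRODUCT HAS THIRD-ORDER DIFFERENCES.**  For units `u₁,…,u₄` and `v₁,…,v₄` of norm `≤ 1` with inverses of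
norm `≤ 1` (`U1`), all within `a` of `1` and with `‖uᵢ − vᵢ‖ ≤ g`, the expression `E(u) = u₁u₂u₃⁻¹u₄⁻¹ − 1 − [(u₁−1) + (u₂−1) − (u₃−1) − (u₄−1)]`
(plaquette variable minus its linear part) satisfies `‖E(u) − E(v)‖ ≤ 16·a·g` — every term of the telescoped difference carries one factor `uᵢ − vᵢ`
AND one factor `w − 1`. [cite: Balaban1985RegularSpaces, (1.2) p.76; Balaban1985Variational, (22)-(24) p.281] -/
theorem norm_plaq_second_order_diff_le {u₁ u₂ u₃ u₄ v₁ v₂ v₃ v₄ : 𝔸ˣ}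
    (hu₂ : u₂ ∈ U1 𝔸) (hu₃ : u₃ ∈ U1 𝔸) (hu₄ : u₄ ∈ U1 𝔸) (hv₁ : v₁ ∈ U1 𝔸) (hv₂ : v₂ ∈ U1 𝔸) (hv₃ : v₃ ∈ U1 𝔸) (hv₄ : v₄ ∈ U1 𝔸)
    {a g : ℝ} (ha : 0 ≤ a) (hg : 0 ≤ g)
    (hau₂ : ‖(u₂ : 𝔸) - 1‖ ≤ a) (hau₃ : ‖(u₃ : 𝔸) - 1‖ ≤ a) (hau₄ : ‖(u₄ : 𝔸) - 1‖ ≤ a)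
    (hav₁ : ‖(v₁ : 𝔸) - 1‖ ≤ a) (hav₂ : ‖(v₂ : 𝔸) - 1‖ ≤ a) (hav₃ : ‖(v₃ : 𝔸) - 1‖ ≤ a) (hav₄ : ‖(v₄ : 𝔸) - 1‖ ≤ a)
    (hg₁ : ‖(u₁ : 𝔸) - v₁‖ ≤ g) (hg₂ : ‖(u₂ : 𝔸) - v₂‖ ≤ g) (hg₃ : ‖(u₃ : 𝔸) - v₃‖ ≤ g) (hg₄ : ‖(u₄ : 𝔸) - v₄‖ ≤ g) :
    ‖(((u₁ * u₂ * u₃⁻¹ * u₄⁻¹ : 𝔸ˣ) : 𝔸) - 1 - (((u₁ : 𝔸) - 1) + ((u₂ : 𝔸) - 1) - ((u₃ : 𝔸) - 1) - ((u₄ : 𝔸) - 1)))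
      - ((((v₁ * v₂ * v₃⁻¹ * v₄⁻¹ : 𝔸ˣ) : 𝔸) - 1 - (((v₁ : 𝔸) - 1) + ((v₂ : 𝔸) - 1) - ((v₃ : 𝔸) - 1) - ((v₄ : 𝔸) - 1))))‖
      ≤ 16 * a * g := by
  -- names for the elements and the inverses
  set A₁ : 𝔸 := (u₁ : 𝔸) with hA₁
  set A₂ : 𝔸 := (u₂ : 𝔸) with hA₂
  set A₃ : 𝔸 := (u₃ : 𝔸) with hA₃
  set A₄ : 𝔸 := (u₄ : 𝔸) with hA₄
  set B₁ : 𝔸 := (v₁ : 𝔸) with hB₁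
  set B₂ : 𝔸 := (v₂ : 𝔸) with hB₂
  set B₃ : 𝔸 := (v₃ : 𝔸) with hB₃
  set B₄ : 𝔸 := (v₄ : 𝔸) with hB₄
  set A₃' : 𝔸 := ((u₃⁻¹ : 𝔸ˣ) : 𝔸) with hA₃'
  set A₄' : 𝔸 := ((u₄⁻¹ : 𝔸ˣ) : 𝔸) with hA₄'
  set B₃' : 𝔸 := ((v₃⁻¹ : 𝔸ˣ) : 𝔸) with hB₃'
  set B₄' : 𝔸 := ((v₄⁻¹ : 𝔸ˣ) : 𝔸) with hB₄'
  -- norms ≤ 1 and deviations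
  have nA₂ : ‖A₂‖ ≤ 1 := hu₂.1
  have nB₁ : ‖B₁‖ ≤ 1 := hv₁.1
  have nB₂ : ‖B₂‖ ≤ 1 := hv₂.1
  have nA₃' : ‖A₃'‖ ≤ 1 := hu₃.2
  have nA₄' : ‖A₄'‖ ≤ 1 := hu₄.2
  have nB₃' : ‖B₃'‖ ≤ 1 := hv₃.2
  have nB₄' : ‖B₄'‖ ≤ 1 := hv₄.2
  have nmul : ∀ {x y : 𝔸}, ‖x‖ ≤ 1 → ‖y‖ ≤ 1 → ‖x * y‖ ≤ 1 := fun hx hy =>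
    (norm_mul_le _ _).trans (mul_le_one₀ hx (norm_nonneg _) hy)
  have dA₃' : ‖A₃' - 1‖ ≤ a := (norm_inv_sub_one_le hu₃).trans hau₃
  have dA₄' : ‖A₄' - 1‖ ≤ a := (norm_inv_sub_one_le hu₄).trans hau₄
  have dB₃' : ‖B₃' - 1‖ ≤ a := (norm_inv_sub_one_le hv₃).trans hav₃
  have dB₄' : ‖B₄' - 1‖ ≤ a := (norm_inv_sub_one_le hv₄).trans hav₄
  -- the products as elements
  have hPu : ((u₁ * u₂ * u₃⁻¹ * u₄⁻¹ : 𝔸ˣ) : 𝔸) = A₁ * A₂ * A₃' * A₄' := by push_cast; rfl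
  have hPv : ((v₁ * v₂ * v₃⁻¹ * v₄⁻¹ : 𝔸ˣ) : 𝔸) = B₁ * B₂ * B₃' * B₄' := by push_cast; rfl
  -- inverse differences
  have h3 : A₃' - B₃' = -(A₃' * (A₃ - B₃) * B₃') := inv_sub_inv_eq u₃ v₃
  have h4 : A₄' - B₄' = -(A₄' * (A₄ - B₄) * B₄') := inv_sub_inv_eq u₄ v₄
  -- the decomposition into four third-order terms
  set T₁ : 𝔸 := (A₁ - B₁) * (A₂ * A₃' * A₄' - 1) with hT₁
  set T₂ : 𝔸 := (B₁ - 1) * (A₂ - B₂) * (A₃' * A₄') + (A₂ - B₂) * (A₃' * A₄' - 1) with hT₂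
  set T₃ : 𝔸 := (1 - B₁ * B₂ * A₃') * (A₃ - B₃) + B₁ * B₂ * A₃' * (A₃ - B₃) * (1 - B₃' * A₄') with hT₃
  set T₄ : 𝔸 := (1 - B₁ * B₂ * B₃' * A₄') * (A₄ - B₄) + B₁ * B₂ * B₃' * A₄' * (A₄ - B₄) * (1 - B₄') with hT₄
  have hdecomp : (A₁ * A₂ * A₃' * A₄' - 1 - ((A₁ - 1) + (A₂ - 1) - (A₃ - 1) - (A₄ - 1)))
      - (B₁ * B₂ * B₃' * B₄' - 1 - ((B₁ - 1) + (B₂ - 1) - (B₃ - 1) - (B₄ - 1))) = T₁ + T₂ + T₃ + T₄ := by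
    -- telescoping of the product, then the inverse differences
    have htel : A₁ * A₂ * A₃' * A₄' - B₁ * B₂ * B₃' * B₄'
        = (A₁ - B₁) * (A₂ * A₃' * A₄') + B₁ * (A₂ - B₂) * (A₃' * A₄') + B₁ * B₂ * (A₃' - B₃') * A₄'
          + B₁ * B₂ * B₃' * (A₄' - B₄') := by noncomm_ring
    rw [h3, h4] at htel
    rw [hT₁, hT₂, hT₃, hT₄]
    have : (A₁ * A₂ * A₃' * A₄' - 1 - ((A₁ - 1) + (A₂ - 1) - (A₃ - 1) - (A₄ - 1)))
        - (B₁ * B₂ * B₃' * B₄' - 1 - ((B₁ - 1) + (B₂ - 1) - (B₃ - 1) - (B₄ - 1)))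
        = (A₁ * A₂ * A₃' * A₄' - B₁ * B₂ * B₃' * B₄') - ((A₁ - B₁) + (A₂ - B₂) - (A₃ - B₃) - (A₄ - B₄)) := by abel
    rw [this, htel]
    noncomm_ring
  rw [hPu, hPv, hdecomp]
  -- bounds on the four terms
  have b1 : ‖T₁‖ ≤ g * (3 * a) := by
    rw [hT₁]
    refine (norm_mul_le _ _).trans (mul_le_mul hg₁ ?_ (norm_nonneg _) hg)
    exact (norm_mul_mul_sub_one_le nA₃' nA₄').trans (by linarith)
  have b2 : ‖T₂‖ ≤ a * g + g * (2 * a) := by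
    rw [hT₂]
    refine (norm_add_le _ _).trans (add_le_add ?_ ?_)
    · calc ‖(B₁ - 1) * (A₂ - B₂) * (A₃' * A₄')‖ ≤ ‖B₁ - 1‖ * ‖A₂ - B₂‖ * ‖A₃' * A₄'‖ :=
            (norm_mul_le _ _).trans (mul_le_mul_of_nonneg_right (norm_mul_le _ _) (norm_nonneg _))
        _ ≤ a * g * 1 := mul_le_mul (mul_le_mul hav₁ hg₂ (norm_nonneg _) ha) (nmul nA₃' nA₄') (norm_nonneg _)
            (by positivity)
        _ = a * g := mul_one _
    · refine (norm_mul_le _ _).trans (mul_le_mul hg₂ ?_ (norm_nonneg _) hg)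
      exact (norm_mul_sub_one_le nA₄').trans (by linarith)
  have hX : ∀ (X L R : 𝔸) (l r : ℝ), ‖X‖ ≤ g → ‖1 - L‖ ≤ l → ‖1 - R‖ ≤ r → ‖L‖ ≤ 1 →
      ‖(1 - L) * X + L * X * (1 - R)‖ ≤ l * g + g * r := by
    intro X L R l r hXg hl hr hL
    refine (norm_add_le _ _).trans (add_le_add ?_ ?_)
    · exact (norm_mul_le _ _).trans (mul_le_mul hl hXg (norm_nonneg _) ((norm_nonneg _).trans hl))
    · calc ‖L * X * (1 - R)‖ ≤ ‖L‖ * ‖X‖ * ‖1 - R‖ :=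
            (norm_mul_le _ _).trans (mul_le_mul_of_nonneg_right (norm_mul_le _ _) (norm_nonneg _))
        _ ≤ 1 * g * r := mul_le_mul (mul_le_mul hL hXg (norm_nonneg _) zero_le_one) hr (norm_nonneg _) (by positivity)
        _ = g * r := by ring
  have b3 : ‖T₃‖ ≤ 3 * a * g + g * (2 * a) := by
    rw [hT₃]
    have hl : ‖1 - B₁ * B₂ * A₃'‖ ≤ 3 * a := by
      rw [norm_sub_rev]; exact (norm_mul_mul_sub_one_le nB₂ nA₃').trans (by linarith)
    have hr : ‖1 - B₃' * A₄'‖ ≤ 2 * a := by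
      rw [norm_sub_rev]; exact (norm_mul_sub_one_le nA₄').trans (by linarith)
    have h := hX (A₃ - B₃) (B₁ * B₂ * A₃') (B₃' * A₄') (3 * a) (2 * a) hg₃ hl hr
      (nmul (nmul nB₁ nB₂) nA₃')
    simpa [mul_assoc] using h
  have b4 : ‖T₄‖ ≤ 4 * a * g + g * a := by
    rw [hT₄]
    have hl : ‖1 - B₁ * B₂ * B₃' * A₄'‖ ≤ 4 * a := by
      rw [norm_sub_rev]; exact (norm_mul_mul_mul_sub_one_le nB₂ nB₃' nA₄').trans (by linarith)
    have hr : ‖1 - B₄'‖ ≤ a := by rw [norm_sub_rev]; exact dB₄'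
    have h := hX (A₄ - B₄) (B₁ * B₂ * B₃' * A₄') B₄' (4 * a) a hg₄ hl hr
      (nmul (nmul (nmul nB₁ nB₂) nB₃') nA₄')
    simpa [mul_assoc] using h
  calc ‖T₁ + T₂ + T₃ + T₄‖ ≤ ‖T₁‖ + ‖T₂‖ + ‖T₃‖ + ‖T₄‖ := norm_add₄_le
    _ ≤ g * (3 * a) + (a * g + g * (2 * a)) + (3 * a * g + g * (2 * a)) + (4 * a * g + g * a) := by gcongr
    _ = 16 * a * g := by ring

end Ring

/-! ## §2 On `ℤ^d`: the flat operator `div₂(curl Y)` against the covariant divergence (1.2) -/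

section Zd

open B7Prop1Explicit (Site)

variable {d : ℕ} {𝔸 : Type*} [NormedRing 𝔸] [NormOneClass 𝔸] [NormedAlgebra ℂ 𝔸]

omit [NormOneClass 𝔸] [NormedAlgebra ℂ 𝔸] in
/-- unfolding of the flat divergence of a 2-chain (`LatticeChain.div₂`) with the unit vectors of `B7Prop1Explicit`. [folklore] -/
theorem div₂_apply (M : Site d → Fin d → Fin d → 𝔸) (y : Site d) (μ : Fin d) :
    div₂ M y μ = ∑ ν : Fin d, (M (y - e ν) ν μ - M y ν μ) := rfl

omit [NormOneClass 𝔸] [NormedAlgebra ℂ 𝔸] in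
/-- The plaquette variable as the product of its four bond units. [cite: Balaban1985Averaging, (9) p.19] -/
theorem plaqF_eq_units_prod (W : Site d → Fin d → 𝔸ˣ) (κ μ : Fin d) (z : Site d) :
    plaqF W κ μ z = ((W z κ * W (z + e κ) μ * (W (z + e μ) κ)⁻¹ * (W z μ)⁻¹ : 𝔸ˣ) : 𝔸) := by
  unfold plaqF
  rw [hol_plaqWord_eq]

omit [NormedAlgebra ℂ 𝔸] in
/-- **THE SECOND-ORDER PART OF THE PLAQUETTE FIELD HAS THIRD-ORDER FLAT DIFFERENCES**: for a `U1`-valued configuration `W = 1 + Y` on `ℤ^d` with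
`‖Y‖ ≤ a` and `‖Y(· − e_ν) − Y‖ ≤ g`, the quantity `E(z; κ, μ) = (F_{κμ}(z) − 1) − [Y(z,κ) + Y(z+e_κ,μ) − Y(z+e_μ,κ) − Y(z,μ)]` (plaquette field minus its flat
curl) satisfies `‖E(y − e_ν) − E(y)‖ ≤ 16·a·g`. [cite: Balaban1985RegularSpaces, (1.2) p.76; Balaban1985Variational, (22)-(24) p.281] -/
theorem norm_plaqF_second_order_diff_le {W : Site d → Fin d → 𝔸ˣ} (hW : ∀ x κ, W x κ ∈ U1 𝔸) {a g : ℝ} (ha : 0 ≤ a) (hg : 0 ≤ g)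
    (haW : ∀ x κ, ‖(W x κ : 𝔸) - 1‖ ≤ a) (ν : Fin d) (hgW : ∀ x κ, ‖(W (x - e ν) κ : 𝔸) - W x κ‖ ≤ g) (κ μ : Fin d) (y : Site d) :
    ‖(plaqF W κ μ (y - e ν) - 1
        - (((W (y - e ν) κ : 𝔸) - 1) + ((W (y - e ν + e κ) μ : 𝔸) - 1) - ((W (y - e ν + e μ) κ : 𝔸) - 1) - ((W (y - e ν) μ : 𝔸) - 1)))
      - (plaqF W κ μ y - 1 - (((W y κ : 𝔸) - 1) + ((W (y + e κ) μ : 𝔸) - 1) - ((W (y + e μ) κ : 𝔸) - 1) - ((W y μ : 𝔸) - 1)))‖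
      ≤ 16 * a * g := by
  rw [plaqF_eq_units_prod, plaqF_eq_units_prod]
  have h2 : ‖(W (y - e ν + e κ) μ : 𝔸) - W (y + e κ) μ‖ ≤ g := by
    have := hgW (y + e κ) μ; rwa [show y + e κ - e ν = y - e ν + e κ by abel] at this
  have h3 : ‖(W (y - e ν + e μ) κ : 𝔸) - W (y + e μ) κ‖ ≤ g := by
    have := hgW (y + e μ) κ; rwa [show y + e μ - e ν = y - e ν + e μ by abel] at this
  exact norm_plaq_second_order_diff_le (hW _ _) (hW _ _) (hW _ _) (hW _ _) (hW _ _) (hW _ _) (hW _ _) ha hg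
    (haW _ _) (haW _ _) (haW _ _) (haW _ _) (haW _ _) (haW _ _) (haW _ _) (hgW y κ) h2 h3 (hgW y μ)

/-- **THE FLAT LINEARISATION OF THE CURRENT ON `ℤ^d`**: for a `U1`-valued `W = 1 + Y` with `‖Y‖ ≤ a`, all plaquettes within `f ≤ 1` of `1` and
`‖Y(· − e_ν) − Y‖ ≤ g` (every `ν`): at every site `y` and direction `μ`
`‖div₂(curl Y)(y; μ) − (D^{1*}_W ∂W)_μ(y)‖ ≤ d·(2·a·f + 2·f² + 16·a·g)`,
`curl Y (z; κ, μ) = Y(z,κ) + Y(z+e_κ,μ) − Y(z+e_μ,κ) − Y(z,μ)` over ALL ordered pairs, `div₂ M (y; μ) = Σ_ν (M(y − e_ν; ν, μ) − M(y; ν, μ))` — the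
remainder is of third order in (bond deviation, plaquette deviation, bond gradient): p1 g13's `CurvGradAxial.norm_div2_sub_covDiv_le` (divergence of
`F − 1` against (1.2)) plus `norm_plaqF_second_order_diff_le` summed over `ν`. [cite: Balaban1985RegularSpaces, (1.2) p.76; Balaban1985Variational, (26)-(28) p.282] -/
theorem norm_div2_curl_sub_covDiv_le {W : Site d → Fin d → 𝔸ˣ} (hW : ∀ x κ, W x κ ∈ U1 𝔸) {a f g : ℝ} (ha : 0 ≤ a) (hf : 0 ≤ f)
    (hg : 0 ≤ g) (haW : ∀ x κ, ‖(W x κ : 𝔸) - 1‖ ≤ a) (hfW : ∀ (x : Site d) (κ μ : Fin d), ‖plaqF W κ μ x - 1‖ ≤ f)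
    (hgW : ∀ (x : Site d) (κ ν : Fin d), ‖(W (x - e ν) κ : 𝔸) - W x κ‖ ≤ g) (y : Site d) (μ : Fin d) :
    ‖div₂ (fun z κ' μ' => ((W z κ' : 𝔸) - 1) + ((W (z + e κ') μ' : 𝔸) - 1) - ((W (z + e μ') κ' : 𝔸) - 1) - ((W z μ' : 𝔸) - 1)) y μ
        - covDiv 1 W μ y‖ ≤ d * (2 * a * f + 2 * f ^ 2 + 16 * a * g) := by
  -- the divergence of `F − 1` against (1.2)
  have h1 : ‖div₂ (fun z κ' μ' => plaqF W κ' μ' z - 1) y μ - covDiv 1 W μ y‖ ≤ d * (2 * a * f + 2 * f ^ 2) :=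
    norm_div2_sub_covDiv_le hW hf hfW y (fun ν => haW _ _) μ
  -- the divergence of `F − 1 − curl Y`
  have h2 : ‖div₂ (fun z κ' μ' => plaqF W κ' μ' z - 1) y μ
      - div₂ (fun z κ' μ' => ((W z κ' : 𝔸) - 1) + ((W (z + e κ') μ' : 𝔸) - 1) - ((W (z + e μ') κ' : 𝔸) - 1) - ((W z μ' : 𝔸) - 1)) y μ‖
        ≤ d * (16 * a * g) := by
    have hsum : div₂ (fun z κ' μ' => plaqF W κ' μ' z - 1) y μ
        - div₂ (fun z κ' μ' => ((W z κ' : 𝔸) - 1) + ((W (z + e κ') μ' : 𝔸) - 1) - ((W (z + e μ') κ' : 𝔸) - 1) - ((W z μ' : 𝔸) - 1)) y μ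
        = ∑ ν : Fin d, ((plaqF W ν μ (y - e ν) - 1
            - (((W (y - e ν) ν : 𝔸) - 1) + ((W (y - e ν + e ν) μ : 𝔸) - 1) - ((W (y - e ν + e μ) ν : 𝔸) - 1) - ((W (y - e ν) μ : 𝔸) - 1)))
          - (plaqF W ν μ y - 1 - (((W y ν : 𝔸) - 1) + ((W (y + e ν) μ : 𝔸) - 1) - ((W (y + e μ) ν : 𝔸) - 1) - ((W y μ : 𝔸) - 1)))) := by
      rw [div₂_apply, div₂_apply, ← Finset.sum_sub_distrib]
      exact Finset.sum_congr rfl fun ν _ => by abel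
    rw [hsum]
    calc _ ≤ ∑ ν : Fin d, ‖(plaqF W ν μ (y - e ν) - 1
            - (((W (y - e ν) ν : 𝔸) - 1) + ((W (y - e ν + e ν) μ : 𝔸) - 1) - ((W (y - e ν + e μ) ν : 𝔸) - 1) - ((W (y - e ν) μ : 𝔸) - 1)))
          - (plaqF W ν μ y - 1 - (((W y ν : 𝔸) - 1) + ((W (y + e ν) μ : 𝔸) - 1) - ((W (y + e μ) ν : 𝔸) - 1) - ((W y μ : 𝔸) - 1)))‖ :=
          norm_sum_le _ _
      _ ≤ ∑ _ν : Fin d, 16 * a * g := Finset.sum_le_sum fun ν _ =>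
          norm_plaqF_second_order_diff_le hW ha hg haW ν (fun x κ => hgW x κ ν) ν μ y
      _ = d * (16 * a * g) := by rw [Finset.sum_const, Finset.card_univ, Fintype.card_fin, nsmul_eq_mul]
  have e1 : div₂ (fun z κ' μ' => ((W z κ' : 𝔸) - 1) + ((W (z + e κ') μ' : 𝔸) - 1) - ((W (z + e μ') κ' : 𝔸) - 1) - ((W z μ' : 𝔸) - 1)) y μ
        - covDiv 1 W μ y
      = (div₂ (fun z κ' μ' => plaqF W κ' μ' z - 1) y μ - covDiv 1 W μ y)
        - (div₂ (fun z κ' μ' => plaqF W κ' μ' z - 1) y μ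
          - div₂ (fun z κ' μ' => ((W z κ' : 𝔸) - 1) + ((W (z + e κ') μ' : 𝔸) - 1) - ((W (z + e μ') κ' : 𝔸) - 1) - ((W z μ' : 𝔸) - 1)) y μ) := by
    abel
  rw [e1]
  refine (norm_sub_le _ _).trans ?_
  have := add_le_add h1 h2
  linarith

end Zd

/-! ## §3 On the Setup torus: the same for `GaugeField P s 𝔸ˣ` through the periodic pullback -/

section Torus

variable {P : Params} {s : ℕ} {𝔸 : Type*} [NormedRing 𝔸] [NormOneClass 𝔸] [NormedAlgebra ℂ 𝔸]

open B10Eq27TorusAxialLog (transl transl_zero transl_add_e transl_sub_e pull pull_apply)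
open B10Eq68TorusRegularity (plaqFT covDivT plaqF_pull covDiv_pull)

/-- **THE FLAT LINEARISATION OF THE CURRENT ON THE TORUS**: for a `U1`-valued torus configuration `V = 1 + Y` with `‖Y‖ ≤ a`, all plaquette variables
within `f` of `1`, and `‖Y(b − e_ν) − Y(b)‖ ≤ g`: at every site `x` and direction `μ`,
`‖Σ_ν [curl Y(x − e_ν; ν, μ) − curl Y(x; ν, μ)] − (D^{1*}_V ∂V)_μ(x)‖ ≤ d·(2·a·f + 2·f² + 16·a·g)` — the covariant divergence of the plaquette
field ([Balaban1985RegularSpaces] (1.2): the divergence clause of [Balaban1985Variational] (2) and the Euler–Lagrange current at the flat background) IS the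
flat second-order operator of the bond field up to third order. [cite: Balaban1985RegularSpaces, (1.2) p.76; Balaban1985Variational, (2) p.278, (26)-(28) p.282] -/
theorem norm_div2_curl_sub_covDivT_le (V : GaugeField P s 𝔸ˣ) (hV : ∀ b, V b ∈ U1 𝔸) {a f g : ℝ} (ha : 0 ≤ a) (hf : 0 ≤ f) (hg : 0 ≤ g)
    (haV : ∀ b, ‖(V b : 𝔸) - 1‖ ≤ a) (hfV : ∀ (x : Site P s) (κ μ : Fin P.d), ‖plaqFT V κ μ x - 1‖ ≤ f)
    (hgV : ∀ (x : Site P s) (κ ν : Fin P.d), ‖(V ⟨x.unshift ν, κ⟩ : 𝔸) - V ⟨x, κ⟩‖ ≤ g)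
    (x : Site P s) (μ : Fin P.d) :
    ‖(∑ ν : Fin P.d,
        ((((V ⟨x.unshift ν, ν⟩ : 𝔸) - 1) + ((V ⟨(x.unshift ν).shift ν, μ⟩ : 𝔸) - 1) - ((V ⟨(x.unshift ν).shift μ, ν⟩ : 𝔸) - 1)
            - ((V ⟨x.unshift ν, μ⟩ : 𝔸) - 1))
          - (((V ⟨x, ν⟩ : 𝔸) - 1) + ((V ⟨x.shift ν, μ⟩ : 𝔸) - 1) - ((V ⟨x.shift μ, ν⟩ : 𝔸) - 1) - ((V ⟨x, μ⟩ : 𝔸) - 1))))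
      - covDivT 1 V μ x‖ ≤ P.d * (2 * a * f + 2 * f ^ 2 + 16 * a * g) := by
  have h := norm_div2_curl_sub_covDiv_le (W := pull V x) (fun z κ => hV _) ha hf hg (fun z κ => haV _)
    (fun z κ μ' => by rw [plaqF_pull]; exact hfV _ _ _)
    (fun z κ ν => by rw [pull_apply, pull_apply, transl_sub_e]; exact hgV _ _ _) 0 μ
  rw [covDiv_pull, transl_zero, div₂_apply] at h
  simp only [pull_apply, transl_add_e, transl_sub_e, transl_zero] at h
  exact h

end Torus

/-! ## §4 The reading at the d = 3 carrier (`U(2)`-valued units of `M₂(ℂ)`, operator norm; e.g. `unitsField (toUField U)` for an `SU(2)` field `U`) -/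

section Carrier

open scoped Matrix.Norms.L2Operator
open B10Eq27TorusAxialLog (unitsField toUField unitsField_mem_unitaryUnits U1_of_unitaryUnits)
open B7Prop2Explicit (unitaryUnits)
open B10Eq68TorusRegularity (plaqFT covDivT)
open T3ContinuumYM3Torus (T3Family)

/-- **AT THE d = 3 CARRIER** of `T3Thm1Carrier.varProblem3 F n K` (fine torus `Site (F.P K) 0`; a unitary-valued units configuration `V` of `M₂(ℂ)` with the
operator norm — e.g. `V = unitsField (toUField U)` for the `SU(2)` field `U`, the reading of `T3PrintedRegularMinimiser.DivSmall`): with `V = 1 + Y`, `‖Y‖ ≤ a`,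
plaquette variables within `f ≤ 1` of `1`, `‖Y(b − e_ν) − Y(b)‖ ≤ g`, the current `(D^{1*}_V ∂V)_μ(x)` of the divergence clause of [Balaban1985Variational] (2)
equals the flat `Σ_ν [curl Y(x − e_ν; ν, μ) − curl Y(x; ν, μ)]` up to `3·(2af + 2f² + 16ag)`. [cite: Balaban1985Variational, (2) p.278; Balaban1985RegularSpaces, (1.2) p.76] -/
theorem norm_div2_curl_sub_covDivT_le_T3 (F : T3Family) (K : ℕ) (V : GaugeField (F.P K) 0 (Matrix (Fin 2) (Fin 2) ℂ)ˣ)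
    (hV : ∀ b, V b ∈ unitaryUnits (Matrix (Fin 2) (Fin 2) ℂ)) {a f g : ℝ} (ha : 0 ≤ a) (hf : 0 ≤ f) (hg : 0 ≤ g)
    (haV : ∀ b, ‖(V b : Matrix (Fin 2) (Fin 2) ℂ) - 1‖ ≤ a)
    (hfV : ∀ (x : Site (F.P K) 0) (κ μ : Fin 3), ‖plaqFT V κ μ x - 1‖ ≤ f)
    (hgV : ∀ (x : Site (F.P K) 0) (κ ν : Fin 3), ‖(V ⟨x.unshift ν, κ⟩ : Matrix (Fin 2) (Fin 2) ℂ) - V ⟨x, κ⟩‖ ≤ g)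
    (x : Site (F.P K) 0) (μ : Fin 3) :
    ‖(∑ ν : Fin 3,
        ((((V ⟨x.unshift ν, ν⟩ : Matrix (Fin 2) (Fin 2) ℂ) - 1) + ((V ⟨(x.unshift ν).shift ν, μ⟩ : Matrix (Fin 2) (Fin 2) ℂ) - 1)
            - ((V ⟨(x.unshift ν).shift μ, ν⟩ : Matrix (Fin 2) (Fin 2) ℂ) - 1) - ((V ⟨x.unshift ν, μ⟩ : Matrix (Fin 2) (Fin 2) ℂ) - 1))
          - (((V ⟨x, ν⟩ : Matrix (Fin 2) (Fin 2) ℂ) - 1) + ((V ⟨x.shift ν, μ⟩ : Matrix (Fin 2) (Fin 2) ℂ) - 1)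
            - ((V ⟨x.shift μ, ν⟩ : Matrix (Fin 2) (Fin 2) ℂ) - 1) - ((V ⟨x, μ⟩ : Matrix (Fin 2) (Fin 2) ℂ) - 1))))
      - covDivT 1 V μ x‖ ≤ 3 * (2 * a * f + 2 * f ^ 2 + 16 * a * g) := by
  have hVm : ∀ b, V b ∈ U1 (Matrix (Fin 2) (Fin 2) ℂ) := by
    letI : CStarAlgebra (Matrix (Fin 2) (Fin 2) ℂ) := B10Eq29TubeLine.cstarAlgebraMatrix 2
    exact U1_of_unitaryUnits hV
  have h := norm_div2_curl_sub_covDivT_le V hVm ha hf hg haV hfV hgV x μ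
  have hd : ((F.P K).d : ℝ) = 3 := by norm_num [show (F.P K).d = 3 from rfl]
  rw [hd] at h
  exact h

/-- The `SU(2)` field of the carrier read in `M₂(ℂ)ˣ` is unitary-valued, so the previous theorem applies to `V = unitsField (toUField U)`.
[cite: Balaban1985Averaging, (19) p.21] -/
theorem unitsField_toUField_mem_unitaryUnits (F : T3Family) (K : ℕ) (U : GaugeField (F.P K) 0 (Matrix.specialUnitaryGroup (Fin 2) ℂ))
    (b : PBond (F.P K) 0) : unitsField (toUField U) b ∈ unitaryUnits (Matrix (Fin 2) (Fin 2) ℂ) :=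
  unitsField_mem_unitaryUnits _ b

end Carrier

end Summit.QuantumFields.YangMills.Theorems.Prop7FlatCurrentLinearisation

end
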